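import Summits.QuantumFields.YangMills.Theorems.BalabanUVNodesN16InteriorOfCapture
import HarnessLib

/-!
# Route «BalabanUVNodes» (K3⁷ `SpineGivenEndpointR13SepCoPH`, stmt-QuantumFields-20544), DAG node N16 = NE3, in-edge N07 → N16 — THE (β16) LOOSE ROAD RE-KEYED AT
# THE SLOT CUBES: its N07 in-edge is «(9)–(10) at the (8)-class minimisers ON THE COLLAR-SLOT CUBES» (+ «(8) in minimal-orbit form» where a selection is read), a
# DISPLAYED hypothesis WEAKER than `∀ k, Thm1At C (torusVP …)` — the repair C′ of [Balaban1985Variational] Theorem 1's torus reading AT THE HYPOTHESIS LEVEL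

Cell `pub-ymgap`, width seat `pub-ymgap-dag-n16-w1` (director-ym №197 ∕ HUMAN RULING D-0149), generation 5, file 9 of this lineage (files 1–8: `…N16H7OfReg9` p584527,
`…N16H7TightWindow` p586490, `…N16H7OfN07RecordSlot` p588364, `…N16H7NoBinding` p593465, `…N16H7Fronts` p596237∕p600107, `…N16H7LooseOfThm1At` p597330∕p599040∕p602214,
`…N16InteriorOfCapture` p606074, `…N16CaptureWitnesses` p607179).  `--kind proof --supports stmt-QuantumFields-20544 --as helper` (count-neutral).
`bears_on: R4∕N16 · edge N07 → N16`.  THEOREMS ONLY (0 `def`, 0 `sorry`, standard axioms); everything BY NAME over landed modules.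

## Why this file (the located event, first-hand)

Every producer of K3⁷ v5's N16 conjuncts on the (β16) LOOSE road of record displays node N07's in-edge as leaf-06's Theorem-1 reading
`(hGm, hG, C, hM, hT)` with `hT : ∀ k, B11Thm1.Thm1At C (MinimalActionDictionary.torusVP d L N G (k+1))` — file 1 §3 `leafH3sup_loose_of_thm1At_torusVP`, file 6, file 7 §2–§4,
file 8 §2, dag-n16-e's modules 43 §4 ∕ 45 ∕ 46, dag-n16-w4's `…N16CaptureOfUnique6`.  dag-n16-w2 g4 (`…N16Thm1AtTorusVPSmallCubesPrep` p607834 + `…N16Thm1AtTorusVPSmallCubes`,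
bus I.≈29595, 2026-08-28T05:46Z) certifies in the kernel that at rank two (`Matrix (Fin 2) (Fin 2) ℂ`) this bundle is UNINHABITED: `torusVP`'s declared divergence D-s3-3
(«cubes ↦ ALL lattice cubes `box K y` with `M = (2K+1)∕(2L^k) ≤ M(ε₁)`») makes `Reg910` speak of `K = 2` cubes with `M = 5∕(2L^j) → 0`, whose M-PROPORTIONAL bound
(9)–(10) forces deep minimisers flat against a constant `SU(2)` datum; print's cubes have `M ∈ R₁M₁ℕ` ([Balaban1985Variational] p. 279 L1–5) and are untouched.  By the
chair's A6 rule the producers above are VACUOUS AS TYPED at the item's `N`.  n16-w2's located repair C′ is «(9)–(10) on print's cube class only»; its remark «N16's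
consumers use the single cube `K = L^{k+1} − 1 + L^{k+1} + 2` (`cubeM_slot_le : M ≤ 7∕2`), so their proofs transfer to C′ by name» is executed HERE, at the hypothesis
level, with no instance edit and no leaf-06 file touched.

## What this file proves (kernel)

* §1 THE SLOT KEY.  The two clauses the loose road actually reads, as DISPLAYED hypotheses over leaf-06's objects: (T9ˢ) `hR` — for every run `k+1`, every `0 < ε₁ ≤ a₁`,
  every datum `V ∈ sfClass d L N ε₁ 0` (print's (7)) and every minimiser `U` of the Wilson action over the (8)-class `sfClass d L N (B₃ε₁) (k+1)` at `V`, and EVERY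
  SITE `x`, r2's `B11.Regularity (torusVP d L N G (k+1)) B₃ B₄ ε₁ U (x, L^{k+1} − 1 + L^{k+1} + 2)` — (9)–(10) in some gauge on the collar-slot cube about `x`, whose size
  parameter satisfies `2 ≤ M ≤ 7∕2` (`two_le_cubeM_slot`, leaf-06's `cubeM_slot_le`); (T8) `hE` — a minimiser of run `k+1` over the (8)-class exists at every such
  datum.  `reg910Slot_of_thm1At_torusVP` ∕ `exists8Min_of_thm1At_torusVP`: the old key `hM ∧ hT` IMPLIES (T9ˢ) ∧ (T8) (projections) — so the new key is WEAKER;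
  `reg910Slot_of_reg910_one_le`: (T9ˢ) also follows from `hM` and «`Reg910` on the cubes with `1 ≤ sizeM c ≤ M(ε₁)`» (n16-w2's second instance-level form of C′), so
  any repair of that shape discharges the key by one application.
* §2 ★★ `leafH3sup_loose_of_reg910Slot` — file 1 §3's conclusion `LeafH3sup d L N ε ε (16937ε) {V ∈ dom | V ∈ sfClass d L N (ε∕B₃) 0}` from `hGm, hG, C, hR` ALONE
  (no `hM`, no `hT`; file 1's proof read the slot cube and nothing else); `h7Shape_loose_of_reg910Slot` (the `∃ C′ ε₀` shape file 6 consumes).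
* §3 file 7's generic rows at the slot key: ★ `leafH3sup_interior_of_reg910Slot_of_capture` (the interior leaf from CAPTURE), `leafH3sup_interior_iff_capture_slot`,
  `exists_isMinimiser_succ_of_exists8Min` ((T8) at the tree's radius), `exists_sel_succ_of_reg910Slot_of_capture`, `exists_sel_of_reg910Slot_of_capture` (N19's two `sel` rows).
* The per-family producers of file 6 at the slot key (`d = 4`, `L = F.L`, the loose object `oL(ℓ, C.B₃)`) are the sibling file `…N16H7LooseOfReg910SlotFamily` (400-line rule);
  dag-n16-e's modules 45∕46 and the pinned-reading rows of file 7 §4 re-key the same way (one application each; not re-typed).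

## What the slot key is and is not

It is [Balaban1985Variational] Theorem 1 (8)–(10) p. 279 READ AT leaf-06's torus objects ON THE CUBES THE ROAD READS: all divergences D-s3-1 (plaquette-only class, no current
clause), D-s3-2 (global minimum), D-s3-4 (one gauge, no Hölder clause), D-s3-6 stand; D-s3-3 is CUT DOWN to the slot cubes (`2 ≤ M ≤ 11∕4 < 7∕2` at runs `k+1 ≥ 1`), which
print covers by restriction from an aligned printed cube `M″ ∈ R₁M₁ℕ` containing them at the cost of the factor `M″∕M ≤ 1 + 3R₁M₁∕2` in `B₃` (a constant; for n16-w2's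
`K = 2` cubes that factor is unbounded — the located content of the refutation).  n16-w2's witness (`M = 5∕(2L^j) → 0`) does not meet the slot cubes; whether (T9ˢ) ∧ (T8)
is inhabited at the tree's objects for some `(G, C)` is node N07's content ([Balaban1985Variational] Thm 1 + the (42)∕(0.4) transfer), displayed and NOT asserted here.
Remark (not used): at rank two (T8) alone already fails for `C.B₃ < 1∕4` by the same constant datum and [Balaban1985Averaging] Prop. 2 (54) (a `B₃ε₁`-class member averages
to a `4B₃ε₁`-small datum); print's `B₃ ≥ 72d³L³B₀` ([Balaban1985Variational] (162)).

HONEST FRAMING.  Bookkeeping over landed theorems BY NAME; NOTHING of Bałaban is asserted or refuted (the slot key, `h5` and CAPTURE are displayed hypotheses inhabited by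
nothing here; `h5` occurs only in the sibling file); `stub_h7` NOT closed; no stub of K3⁷ v5 named or closed; N16 ∕ N07 ∕ N19 NOT discharged; count-neutral; counts of record unmoved (typed 28∕28 · discharged
5∕27 · A 5∕28); one finite four-torus at fixed `ε`, Bałaban AS PRINTED — NOT ℝ⁴, NOT infinite volume, NOT OS, NOT a mass gap; the YM mass gap (Clay) is NOT proved by any of
this — R4 closes the conditional finite-𝕋⁴ rung `BalabanLadder.UV` only.
-/

set_option autoImplicit false

open scoped BigOperators Matrix Matrix.Norms.L2Operator
open NormedSpace

namespace Summit.QuantumFields.YangMills.BalabanUVNodes.N16H7LooseOfReg910Slot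

open Literature.MathematicalPhysics.QuantumFieldTheory.Balaban1983to89
open B7Prop1Explicit B7Prop2Explicit MatrixLog UnitaryModel
open T4AveragingDeficitWall hiding Site Plane Plaq Bond
open Summit.QuantumFields.BalabanUV.T4Continuum
open AveragingDeficitLatticeH2Prep (fd)
open MinimalActionSandwich (IsMinimiser)
open MinimalActionRate (sfClass)
open MinimalActionRefine (RegularSup)
open MinimalActionDictionary (torusVP RadiiMono cubeM cubeM_slot_le gauge_of_regularity sfClass_mono isMinimiser_zero)
open LevelZeroRegular (regularSup_zero_of_sfClass_le)
open NE3.LeafIndexSockets (LeafH3sup)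
open B11 (Regularity)
open B11Thm1 (Thm1At)
open Summit.QuantumFields.YangMills.BalabanUVNodes.N16H7OfReg9 (leafH3sup_of_reg9AtMinimisers leafH3sup_mono)
open Summit.QuantumFields.YangMills.BalabanUVNodes.N16InteriorOfCapture (capture_of_leafH3sup isMinimiser_of_capture)

noncomputable section

variable {d : ℕ} {n : Type} [Fintype n] [DecidableEq n]

/-! ## §1 The slot key: (9)–(10) at the (8)-class minimisers on the collar-slot cubes, (8) in minimal-orbit form; the old key implies it -/

/-- The collar-slot cube `K = L^k − 1 + L^k + 2` of run `k` has size parameter `M = (2K+1)∕(2L^k) = 2 + 3∕(2L^k) ≥ 2` (with leaf-06's `cubeM_slot_le`: `2 ≤ M ≤ 7∕2`) — it is NOT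
one of the small cubes `M = 5∕(2L^j) → 0` of dag-n16-w2's witness. [folklore] -/
theorem two_le_cubeM_slot {L : ℕ} (hL : 1 ≤ L) (k : ℕ) : 2 ≤ cubeM L k (L ^ k - 1 + L ^ k + 2) := by
  have h1 : 1 ≤ L ^ k := Nat.one_le_pow _ _ hL
  have hK : ((L ^ k - 1 + L ^ k + 2 : ℕ) : ℝ) = 2 * (L : ℝ) ^ k + 1 := by
    have : L ^ k - 1 + L ^ k + 2 = 2 * L ^ k + 1 := by omega
    rw [this]; push_cast; ring
  have hLk : (0 : ℝ) < (L : ℝ) ^ k := by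
    have hL0 : (0 : ℝ) < L := by exact_mod_cast (by omega : 0 < L)
    positivity
  unfold cubeM
  rw [hK, le_div_iff₀ (by positivity)]
  nlinarith

/-- **THE OLD KEY IMPLIES THE SLOT KEY (T9ˢ)**: from `hM : M(e) ≥ 7∕2` and `hT : ∀ k, Thm1At C (torusVP d L N G (k+1))` ([Balaban1985Variational] Thm 1 at leaf-06's torus
instances, ALL lattice cubes — the reading dag-n16-w2 refutes at rank two), the regularity clause at the (8)-class minimisers on the collar-slot cubes is a PROJECTION
(`Reg910` at the cube `(x, L^{k+1} − 1 + L^{k+1} + 2)`, `cubeM ≤ 7∕2 ≤ M(ε₁)`).  So every theorem below keyed on (T9ˢ) is WEAKER-KEYED than its file 1∕6∕7 original.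
[cite: Balaban1985Variational, Thm 1 (9)–(10) p.279] -/
theorem reg910Slot_of_thm1At_torusVP {L N : ℕ} (hL : 1 ≤ L) {G : (Site d → Fin d → (Matrix n n ℂ)ˣ) → Site d → ℕ → ℝ → ℝ → ℝ → Prop}
    (C : B11Thm1.Consts) (hM : ∀ e : ℝ, 0 < e → e ≤ C.a₁ → 7 / 2 ≤ C.Mfun e)
    (hT : ∀ k : ℕ, Thm1At C (torusVP d L N G (k + 1))) :
    ∀ (k : ℕ) (ε₁ : ℝ), 0 < ε₁ → ε₁ ≤ C.a₁ → ∀ (V U : Site d → Fin d → (Matrix n n ℂ)ˣ), V ∈ sfClass d L N ε₁ 0 →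
      IsMinimiser d (sfClass d L N (C.B₃ * ε₁)) L N (k + 1) V U →
        ∀ x : Site d, Regularity (torusVP d L N G (k + 1)) C.B₃ C.B₄ ε₁ U (x, L ^ (k + 1) - 1 + L ^ (k + 1) + 2) := by
  intro k ε₁ hε₁ hε₁a V U hV hU x
  obtain ⟨-, -, h910⟩ := hT k ε₁ hε₁ hε₁a V hV
  have hsize : cubeM L (k + 1) (L ^ (k + 1) - 1 + L ^ (k + 1) + 2) ≤ 7 / 2 := cubeM_slot_le hL (k + 1)
  exact h910 U hU _ (hsize.trans (hM _ hε₁ hε₁a))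

/-- **THE OLD KEY IMPLIES (T8)**: Theorem 1's existence clause (8) at the torus instances, in the minimal-orbit form the road reads (`OnMinimalOrbit (B₃ε₁) V U` of the
instance is `IsMinimiser d (sfClass d L N (B₃ε₁)) L N (k+1) V U` by `rfl`). [cite: Balaban1985Variational, Thm 1 (8) p.279] -/
theorem exists8Min_of_thm1At_torusVP {L N : ℕ} {G : (Site d → Fin d → (Matrix n n ℂ)ˣ) → Site d → ℕ → ℝ → ℝ → ℝ → Prop}
    (C : B11Thm1.Consts) (hT : ∀ k : ℕ, Thm1At C (torusVP d L N G (k + 1))) :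
    ∀ (k : ℕ) (ε₁ : ℝ), 0 < ε₁ → ε₁ ≤ C.a₁ → ∀ V : Site d → Fin d → (Matrix n n ℂ)ˣ, V ∈ sfClass d L N ε₁ 0 →
      ∃ U : Site d → Fin d → (Matrix n n ℂ)ˣ, IsMinimiser d (sfClass d L N (C.B₃ * ε₁)) L N (k + 1) V U := by
  intro k ε₁ hε₁ hε₁a V hV
  obtain ⟨⟨U, -, -, hmin⟩, -, -⟩ := hT k ε₁ hε₁ hε₁a V hV
  exact ⟨U, hmin⟩

/-- **(T9ˢ) FROM THE INSTANCE-LEVEL REPAIR «`Reg910` ON THE CUBES WITH `1 ≤ M ≤ M(ε₁)`»** (dag-n16-w2's second form of C′ — print's cube class has `M ∈ R₁M₁ℕ`, `R₁M₁ ≥ 1`)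
and `hM : M(e) ≥ 7∕2`: the collar-slot cube has `1 ≤ 2 ≤ M ≤ 7∕2`.  So any future instance whose regularity clause is cut to `1 ≤ sizeM` discharges the slot key by one
application. [cite: Balaban1985Variational, Thm 1 (9)–(10) p.279] -/
theorem reg910Slot_of_reg910_one_le {L N : ℕ} (hL : 1 ≤ L) {G : (Site d → Fin d → (Matrix n n ℂ)ˣ) → Site d → ℕ → ℝ → ℝ → ℝ → Prop}
    (C : B11Thm1.Consts) (hM : ∀ e : ℝ, 0 < e → e ≤ C.a₁ → 7 / 2 ≤ C.Mfun e)
    (hR1 : ∀ (k : ℕ) (ε₁ : ℝ), 0 < ε₁ → ε₁ ≤ C.a₁ → ∀ (V U : Site d → Fin d → (Matrix n n ℂ)ˣ), V ∈ sfClass d L N ε₁ 0 →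
      IsMinimiser d (sfClass d L N (C.B₃ * ε₁)) L N (k + 1) V U →
        ∀ c : Site d × ℕ, 1 ≤ cubeM L (k + 1) c.2 → cubeM L (k + 1) c.2 ≤ C.Mfun ε₁ → Regularity (torusVP d L N G (k + 1)) C.B₃ C.B₄ ε₁ U c) :
    ∀ (k : ℕ) (ε₁ : ℝ), 0 < ε₁ → ε₁ ≤ C.a₁ → ∀ (V U : Site d → Fin d → (Matrix n n ℂ)ˣ), V ∈ sfClass d L N ε₁ 0 →
      IsMinimiser d (sfClass d L N (C.B₃ * ε₁)) L N (k + 1) V U →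
        ∀ x : Site d, Regularity (torusVP d L N G (k + 1)) C.B₃ C.B₄ ε₁ U (x, L ^ (k + 1) - 1 + L ^ (k + 1) + 2) := by
  intro k ε₁ hε₁ hε₁a V U hV hU x
  have h2 := two_le_cubeM_slot hL (k + 1)
  exact hR1 k ε₁ hε₁ hε₁a V U hV hU (x, _) (by linarith) ((cubeM_slot_le hL (k + 1)).trans (hM _ hε₁ hε₁a))

/-! ## §2 The loose leaf from the slot key (file 1 §3 re-keyed) -/

/-- **★★ THE LEAF (H3ˢᵘᵖ) ON LOOSE DATA FROM THE SLOT KEY.**  Let `L ≥ 1`; `G` a local-gauge shape monotone in its radii (`hGm`) with the (9)_{β₀=1} interface `hG` (on a cube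
`box K x`, `K ≥ 2`, `G U x K α₀ α₁ α₂` supplies a unitary gauge `u` and potential `a` with `U^u = exp a`, `‖a‖ ≤ α₀` within `|·|₁ ≤ 2` of `x`, `‖∇a‖ ≤ α₁` within `1`,
`‖∇∇a(x)‖ ≤ α₂`); constants `C : B11Thm1.Consts`; and the SLOT KEY (T9ˢ) `hR` (§1; DISPLAYED, asserted for nothing).  THEN for `0 < ε ≤ min(B₃a₁, 1∕28)` and every `dom`:
`LeafH3sup d L N ε ε (16937·ε) {V | V ∈ dom ∧ V ∈ sfClass d L N (ε∕B₃) 0}` — file 1 §3's conclusion VERBATIM, WITHOUT `hM` and WITHOUT `∀ k, Thm1At C (torusVP …)`.  Proof =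
file 1's: (T9ˢ) at `ε₁ := ε∕B₃` (its class `sfClass (B₃ε₁)` IS the tree's class of radius `ε`) gives `Regularity` on the collar-slot cube about each `x`;
`gauge_of_regularity` (common factor `t = 7ε∕2`, `cubeM_slot_le`), `hG`, and file 1 §2 (`leafH3sup_of_reg9AtMinimisers` at `A₀ = A₁ = A₂ = 7∕2`).
[cite: Balaban1985Variational, Thm 1 (9)–(10) p.279] -/
theorem leafH3sup_loose_of_reg910Slot [Nonempty n] {L N : ℕ} (hL : 1 ≤ L)
    {G : (Site d → Fin d → (Matrix n n ℂ)ˣ) → Site d → ℕ → ℝ → ℝ → ℝ → Prop} (hGm : RadiiMono d G)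
    (hG : ∀ (U : Site d → Fin d → (Matrix n n ℂ)ˣ) (x : Site d) (K : ℕ) (α₀ α₁ α₂ : ℝ), 2 ≤ K → G U x K α₀ α₁ α₂ →
      ∃ (u : Site d → (Matrix n n ℂ)ˣ) (a : Site d → Fin d → Matrix n n ℂ),
        (∀ z, u z ∈ unitaryUnits (Matrix n n ℂ)) ∧
        (∀ (y : Site d) (τ : Fin d), l1 (y - x) ≤ 2 → ((gaugeAct u U y τ : (Matrix n n ℂ)ˣ) : Matrix n n ℂ) = exp (a y τ)) ∧
        (∀ (y : Site d) (τ : Fin d), l1 (y - x) ≤ 2 → ‖a y τ‖ ≤ α₀) ∧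
        (∀ (y : Site d) (τ i : Fin d), l1 (y - x) ≤ 1 → ‖fd i (fun z => a z τ) y‖ ≤ α₁) ∧
        (∀ (τ i l : Fin d), ‖fd i (fd l (fun z => a z τ)) x‖ ≤ α₂))
    (C : B11Thm1.Consts)
    (hR : ∀ (k : ℕ) (ε₁ : ℝ), 0 < ε₁ → ε₁ ≤ C.a₁ → ∀ (V U : Site d → Fin d → (Matrix n n ℂ)ˣ), V ∈ sfClass d L N ε₁ 0 →
      IsMinimiser d (sfClass d L N (C.B₃ * ε₁)) L N (k + 1) V U →
        ∀ x : Site d, Regularity (torusVP d L N G (k + 1)) C.B₃ C.B₄ ε₁ U (x, L ^ (k + 1) - 1 + L ^ (k + 1) + 2))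
    {ε : ℝ} (hε : 0 < ε) (hεa : ε ≤ C.B₃ * C.a₁) (hε28 : ε ≤ 1 / 28)
    (dom : Set (Site d → Fin d → (Matrix n n ℂ)ˣ)) :
    LeafH3sup d L N ε ε (16937 * ε) {V | V ∈ dom ∧ V ∈ sfClass d L N (ε / C.B₃) 0} := by
  have hB₃ := C.B₃_pos
  have hε₁ : 0 < ε / C.B₃ := div_pos hε hB₃
  have hε₁a : ε / C.B₃ ≤ C.a₁ := by rw [div_le_iff₀ hB₃]; linarith [mul_comm C.B₃ C.a₁]
  have hBε : C.B₃ * (ε / C.B₃) = ε := by field_simp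
  have hAε : (7 / 2 : ℝ) * ε ≤ 1 / 8 := by linarith
  -- the (9)-TYPE gauges at every minimiser with a loose datum, from the slot key at `ε₁ := ε / B₃`
  have h9 : ∀ V ∈ {V | V ∈ dom ∧ V ∈ sfClass d L N (ε / C.B₃) 0}, ∀ (k : ℕ) (U : Site d → Fin d → (Matrix n n ℂ)ˣ),
      IsMinimiser d (sfClass d L N ε) L N (k + 1) V U →
      ∀ x : Site d, ∃ (u : Site d → (Matrix n n ℂ)ˣ) (a : Site d → Fin d → Matrix n n ℂ),
        (∀ z, u z ∈ unitaryUnits (Matrix n n ℂ)) ∧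
        (∀ (y : Site d) (τ : Fin d), l1 (y - x) ≤ 2 → ((gaugeAct u U y τ : (Matrix n n ℂ)ˣ) : Matrix n n ℂ) = exp (a y τ)) ∧
        (∀ (y : Site d) (τ : Fin d), l1 (y - x) ≤ 2 → ‖a y τ‖ ≤ 7 / 2 * ε / (L : ℝ) ^ (k + 1)) ∧
        (∀ (y : Site d) (τ i : Fin d), l1 (y - x) ≤ 1 → ‖fd i (fun z => a z τ) y‖ ≤ 7 / 2 * ε / ((L : ℝ) ^ (k + 1)) ^ 2) ∧
        (∀ (τ i l : Fin d), ‖fd i (fd l (fun z => a z τ)) x‖ ≤ 7 / 2 * ε / ((L : ℝ) ^ (k + 1)) ^ 3) := by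
    rintro V ⟨-, hV7⟩ k U hU x
    have hmin : IsMinimiser d (sfClass d L N (C.B₃ * (ε / C.B₃))) L N (k + 1) V U := by rw [hBε]; exact hU
    -- the regularity cube about `x`: `K = L^{k+1} − 1 + L^{k+1} + 2`, `cubeM ≤ 7/2`
    have hK2 : 2 ≤ L ^ (k + 1) - 1 + L ^ (k + 1) + 2 := by omega
    have hsize : cubeM L (k + 1) (L ^ (k + 1) - 1 + L ^ (k + 1) + 2) ≤ 7 / 2 := cubeM_slot_le hL (k + 1)
    have hreg : Regularity (torusVP d L N G (k + 1)) C.B₃ C.B₄ (ε / C.B₃) U (x, L ^ (k + 1) - 1 + L ^ (k + 1) + 2) :=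
      hR k (ε / C.B₃) hε₁ hε₁a V U hV7 hmin x
    have hc : C.B₃ * cubeM L (k + 1) (L ^ (k + 1) - 1 + L ^ (k + 1) + 2) * (ε / C.B₃) ≤ 7 / 2 * ε := by
      have h1 : C.B₃ * cubeM L (k + 1) (L ^ (k + 1) - 1 + L ^ (k + 1) + 2) * (ε / C.B₃)
          = cubeM L (k + 1) (L ^ (k + 1) - 1 + L ^ (k + 1) + 2) * ε := by field_simp
      rw [h1]; exact mul_le_mul_of_nonneg_right hsize hε.le
    exact hG U x _ _ _ _ hK2 (gauge_of_regularity hGm hL hreg hc)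
  -- file 1 §2's dictionary at `A₀ = A₁ = A₂ = 7/2`, then the numeral
  have hleaf := leafH3sup_of_reg9AtMinimisers hL hε.le (by linarith) (by norm_num : (0 : ℝ) ≤ 7 / 2) (by norm_num : (0 : ℝ) ≤ 7 / 2)
    hAε hAε h9
  refine leafH3sup_mono hleaf le_rfl ?_
  have hnum : (2 * (7 / 2 : ℝ) + 90 * (7 / 2) * (7 / 2) + 32 * (7 / 2) ^ 2 + 360 * (7 / 2) ^ 3) ≤ 16937 := by norm_num
  exact mul_le_mul_of_nonneg_right hnum hε.le

/-- **THE `∃ C′ ε₀` SHAPE ON LOOSE DATA FROM THE SLOT KEY** (`C′ = 16937`, `ε₀ = min(B₃a₁, 1∕28)`; data cut to `sfClass d L N (ε∕B₃) 0`) — the hypothesis `h7L` of file 6's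
leaf-keyed producers, now WITHOUT `hM`∕`hT`. [cite: Balaban1985Variational, Thm 1 (9)–(10) p.279] -/
theorem h7Shape_loose_of_reg910Slot [Nonempty n] {L N : ℕ} (hL : 1 ≤ L)
    {G : (Site d → Fin d → (Matrix n n ℂ)ˣ) → Site d → ℕ → ℝ → ℝ → ℝ → Prop} (hGm : RadiiMono d G)
    (hG : ∀ (U : Site d → Fin d → (Matrix n n ℂ)ˣ) (x : Site d) (K : ℕ) (α₀ α₁ α₂ : ℝ), 2 ≤ K → G U x K α₀ α₁ α₂ →
      ∃ (u : Site d → (Matrix n n ℂ)ˣ) (a : Site d → Fin d → Matrix n n ℂ),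
        (∀ z, u z ∈ unitaryUnits (Matrix n n ℂ)) ∧
        (∀ (y : Site d) (τ : Fin d), l1 (y - x) ≤ 2 → ((gaugeAct u U y τ : (Matrix n n ℂ)ˣ) : Matrix n n ℂ) = exp (a y τ)) ∧
        (∀ (y : Site d) (τ : Fin d), l1 (y - x) ≤ 2 → ‖a y τ‖ ≤ α₀) ∧
        (∀ (y : Site d) (τ i : Fin d), l1 (y - x) ≤ 1 → ‖fd i (fun z => a z τ) y‖ ≤ α₁) ∧
        (∀ (τ i l : Fin d), ‖fd i (fd l (fun z => a z τ)) x‖ ≤ α₂))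
    (C : B11Thm1.Consts)
    (hR : ∀ (k : ℕ) (ε₁ : ℝ), 0 < ε₁ → ε₁ ≤ C.a₁ → ∀ (V U : Site d → Fin d → (Matrix n n ℂ)ˣ), V ∈ sfClass d L N ε₁ 0 →
      IsMinimiser d (sfClass d L N (C.B₃ * ε₁)) L N (k + 1) V U →
        ∀ x : Site d, Regularity (torusVP d L N G (k + 1)) C.B₃ C.B₄ ε₁ U (x, L ^ (k + 1) - 1 + L ^ (k + 1) + 2))
    (dom : Set (Site d → Fin d → (Matrix n n ℂ)ˣ)) :
    ∃ C' ε₀ : ℝ, 0 ≤ C' ∧ 0 < ε₀ ∧ ∀ ε : ℝ, 0 < ε → ε ≤ ε₀ →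
      LeafH3sup d L N ε (C' * ε) (C' * ε) {V | V ∈ dom ∧ V ∈ sfClass d L N (ε / C.B₃) 0} := by
  refine ⟨16937, min (C.B₃ * C.a₁) (1 / 28), by norm_num, lt_min (mul_pos C.B₃_pos C.a₁_pos) (by norm_num), fun ε hε hεle => ?_⟩
  have h := leafH3sup_loose_of_reg910Slot hL hGm hG C hR hε (hεle.trans (min_le_left _ _)) (hεle.trans (min_le_right _ _)) dom
  exact leafH3sup_mono h (by nlinarith) le_rfl

/-! ## §3 File 7's generic rows at the slot key: the interior leaf from CAPTURE, (8) at the tree's radius, the `sel` rows -/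

/-- **★ THE INTERIOR LEAF FROM THE SLOT KEY AND CAPTURE** (file 7 §2 re-keyed): for a capture radius `0 < ρ ≤ ε`, `ρ ≤ B₃a₁`, `ρ ≤ 1∕28`, data `D` loose at `ρ∕B₃`, and
CAPTURE(ε → ρ) on `D` (DISPLAYED), `LeafH3sup d L N ε ρ (16937ρ) D`: the captured `ε`-minimiser is a `ρ`-minimiser (file 7 §1) and §2 at radius `ρ` is (9)–(10) for it.
[cite: Balaban1985Variational, Thm 1 (9)–(10) p.279] -/
theorem leafH3sup_interior_of_reg910Slot_of_capture [Nonempty n] {L N : ℕ} (hL : 1 ≤ L)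
    {G : (Site d → Fin d → (Matrix n n ℂ)ˣ) → Site d → ℕ → ℝ → ℝ → ℝ → Prop} (hGm : RadiiMono d G)
    (hG : ∀ (U : Site d → Fin d → (Matrix n n ℂ)ˣ) (x : Site d) (K : ℕ) (α₀ α₁ α₂ : ℝ), 2 ≤ K → G U x K α₀ α₁ α₂ →
      ∃ (u : Site d → (Matrix n n ℂ)ˣ) (a : Site d → Fin d → Matrix n n ℂ),
        (∀ z, u z ∈ unitaryUnits (Matrix n n ℂ)) ∧
        (∀ (y : Site d) (τ : Fin d), l1 (y - x) ≤ 2 → ((gaugeAct u U y τ : (Matrix n n ℂ)ˣ) : Matrix n n ℂ) = exp (a y τ)) ∧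
        (∀ (y : Site d) (τ : Fin d), l1 (y - x) ≤ 2 → ‖a y τ‖ ≤ α₀) ∧
        (∀ (y : Site d) (τ i : Fin d), l1 (y - x) ≤ 1 → ‖fd i (fun z => a z τ) y‖ ≤ α₁) ∧
        (∀ (τ i l : Fin d), ‖fd i (fd l (fun z => a z τ)) x‖ ≤ α₂))
    (C : B11Thm1.Consts)
    (hR : ∀ (k : ℕ) (ε₁ : ℝ), 0 < ε₁ → ε₁ ≤ C.a₁ → ∀ (V U : Site d → Fin d → (Matrix n n ℂ)ˣ), V ∈ sfClass d L N ε₁ 0 →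
      IsMinimiser d (sfClass d L N (C.B₃ * ε₁)) L N (k + 1) V U →
        ∀ x : Site d, Regularity (torusVP d L N G (k + 1)) C.B₃ C.B₄ ε₁ U (x, L ^ (k + 1) - 1 + L ^ (k + 1) + 2))
    {ε ρ : ℝ} (hρ : 0 < ρ) (hρε : ρ ≤ ε) (hρa : ρ ≤ C.B₃ * C.a₁) (hρ28 : ρ ≤ 1 / 28)
    {D : Set (Site d → Fin d → (Matrix n n ℂ)ˣ)} (hD : D ⊆ sfClass d L N (ρ / C.B₃) 0)
    (hcap : ∀ V ∈ D, ∀ (k : ℕ) (U : Site d → Fin d → (Matrix n n ℂ)ˣ), IsMinimiser d (sfClass d L N ε) L N (k + 1) V U → U ∈ sfClass d L N ρ (k + 1)) :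
    LeafH3sup d L N ε ρ (16937 * ρ) D := by
  have hleaf := leafH3sup_loose_of_reg910Slot hL hGm hG C hR hρ hρa hρ28 D
  intro V hV k U hU
  exact hleaf V ⟨hV, hD hV⟩ k U (isMinimiser_of_capture hρε hU (hcap V hV k U hU))

/-- **THE EQUIVALENCE AT THE SLOT KEY** (file 7's `leafH3sup_interior_iff_capture` re-keyed): for a Theorem-1 radius `0 < ρ ≤ min(ε, B₃a₁, 1∕28)` and data loose at `ρ∕B₃`,
the interior leaf holds IFF CAPTURE(ε → ρ) does. [cite: Balaban1985Variational, Thm 1 (9)–(10) p.279] -/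
theorem leafH3sup_interior_iff_capture_slot [Nonempty n] {L N : ℕ} (hL : 1 ≤ L)
    {G : (Site d → Fin d → (Matrix n n ℂ)ˣ) → Site d → ℕ → ℝ → ℝ → ℝ → Prop} (hGm : RadiiMono d G)
    (hG : ∀ (U : Site d → Fin d → (Matrix n n ℂ)ˣ) (x : Site d) (K : ℕ) (α₀ α₁ α₂ : ℝ), 2 ≤ K → G U x K α₀ α₁ α₂ →
      ∃ (u : Site d → (Matrix n n ℂ)ˣ) (a : Site d → Fin d → Matrix n n ℂ),
        (∀ z, u z ∈ unitaryUnits (Matrix n n ℂ)) ∧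
        (∀ (y : Site d) (τ : Fin d), l1 (y - x) ≤ 2 → ((gaugeAct u U y τ : (Matrix n n ℂ)ˣ) : Matrix n n ℂ) = exp (a y τ)) ∧
        (∀ (y : Site d) (τ : Fin d), l1 (y - x) ≤ 2 → ‖a y τ‖ ≤ α₀) ∧
        (∀ (y : Site d) (τ i : Fin d), l1 (y - x) ≤ 1 → ‖fd i (fun z => a z τ) y‖ ≤ α₁) ∧
        (∀ (τ i l : Fin d), ‖fd i (fd l (fun z => a z τ)) x‖ ≤ α₂))
    (C : B11Thm1.Consts)
    (hR : ∀ (k : ℕ) (ε₁ : ℝ), 0 < ε₁ → ε₁ ≤ C.a₁ → ∀ (V U : Site d → Fin d → (Matrix n n ℂ)ˣ), V ∈ sfClass d L N ε₁ 0 →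
      IsMinimiser d (sfClass d L N (C.B₃ * ε₁)) L N (k + 1) V U →
        ∀ x : Site d, Regularity (torusVP d L N G (k + 1)) C.B₃ C.B₄ ε₁ U (x, L ^ (k + 1) - 1 + L ^ (k + 1) + 2))
    {ε ρ : ℝ} (hρ : 0 < ρ) (hρε : ρ ≤ ε) (hρa : ρ ≤ C.B₃ * C.a₁) (hρ28 : ρ ≤ 1 / 28)
    {D : Set (Site d → Fin d → (Matrix n n ℂ)ˣ)} (hD : D ⊆ sfClass d L N (ρ / C.B₃) 0) :
    LeafH3sup d L N ε ρ (16937 * ρ) D ↔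
      ∀ V ∈ D, ∀ (k : ℕ) (U : Site d → Fin d → (Matrix n n ℂ)ˣ), IsMinimiser d (sfClass d L N ε) L N (k + 1) V U → U ∈ sfClass d L N ρ (k + 1) :=
  ⟨capture_of_leafH3sup, leafH3sup_interior_of_reg910Slot_of_capture hL hGm hG C hR hρ hρε hρa hρ28 hD⟩

/-- **(T8) AT THE TREE'S RADIUS** (file 7's `exists_isMinimiser_succ_of_thm1At_torusVP` re-keyed): from the existence clause `hE` (DISPLAYED), a minimiser of every run `k+1`
over `sfClass d L N ε` exists at every loose datum `V ∈ sfClass d L N (ε∕B₃) 0`, `0 < ε ≤ B₃a₁` ((8) at `ε₁ = ε∕B₃`). [cite: Balaban1985Variational, Thm 1 (8) p.279] -/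
theorem exists_isMinimiser_succ_of_exists8Min {L N : ℕ} (C : B11Thm1.Consts)
    (hE : ∀ (k : ℕ) (ε₁ : ℝ), 0 < ε₁ → ε₁ ≤ C.a₁ → ∀ V : Site d → Fin d → (Matrix n n ℂ)ˣ, V ∈ sfClass d L N ε₁ 0 →
      ∃ U : Site d → Fin d → (Matrix n n ℂ)ˣ, IsMinimiser d (sfClass d L N (C.B₃ * ε₁)) L N (k + 1) V U)
    {ε : ℝ} (hε : 0 < ε) (hεa : ε ≤ C.B₃ * C.a₁) {V : Site d → Fin d → (Matrix n n ℂ)ˣ} (hV : V ∈ sfClass d L N (ε / C.B₃) 0) (k : ℕ) :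
    ∃ U : Site d → Fin d → (Matrix n n ℂ)ˣ, IsMinimiser d (sfClass d L N ε) L N (k + 1) V U := by
  have hB₃ := C.B₃_pos
  have hε₁ : 0 < ε / C.B₃ := div_pos hε hB₃
  have hε₁a : ε / C.B₃ ≤ C.a₁ := by rw [div_le_iff₀ hB₃]; linarith [mul_comm C.B₃ C.a₁]
  have hBε : C.B₃ * (ε / C.B₃) = ε := by field_simp
  obtain ⟨U, hmin⟩ := hE k (ε / C.B₃) hε₁ hε₁a V hV
  rw [hBε] at hmin
  exact ⟨U, hmin⟩

/-- **THE SELECTION AT RUNS `k+1` FROM (T8), THE SLOT KEY AND CAPTURE** (file 7's `exists_sel_succ_of_thm1At_torusVP_of_capture` re-keyed): under §3's hypotheses and the row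
`ε ≤ B₃a₁`, a selection `sel k V` of minimisers of run `k+1` over `sfClass ε` at the data of `D`, each with sup-form regularity `(ρ, 16937ρ)`.
[cite: Balaban1985Variational, Thm 1 (8)–(10) p.279] -/
theorem exists_sel_succ_of_reg910Slot_of_capture [Nonempty n] {L N : ℕ} (hL : 1 ≤ L)
    {G : (Site d → Fin d → (Matrix n n ℂ)ˣ) → Site d → ℕ → ℝ → ℝ → ℝ → Prop} (hGm : RadiiMono d G)
    (hG : ∀ (U : Site d → Fin d → (Matrix n n ℂ)ˣ) (x : Site d) (K : ℕ) (α₀ α₁ α₂ : ℝ), 2 ≤ K → G U x K α₀ α₁ α₂ →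
      ∃ (u : Site d → (Matrix n n ℂ)ˣ) (a : Site d → Fin d → Matrix n n ℂ),
        (∀ z, u z ∈ unitaryUnits (Matrix n n ℂ)) ∧
        (∀ (y : Site d) (τ : Fin d), l1 (y - x) ≤ 2 → ((gaugeAct u U y τ : (Matrix n n ℂ)ˣ) : Matrix n n ℂ) = exp (a y τ)) ∧
        (∀ (y : Site d) (τ : Fin d), l1 (y - x) ≤ 2 → ‖a y τ‖ ≤ α₀) ∧
        (∀ (y : Site d) (τ i : Fin d), l1 (y - x) ≤ 1 → ‖fd i (fun z => a z τ) y‖ ≤ α₁) ∧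
        (∀ (τ i l : Fin d), ‖fd i (fd l (fun z => a z τ)) x‖ ≤ α₂))
    (C : B11Thm1.Consts)
    (hR : ∀ (k : ℕ) (ε₁ : ℝ), 0 < ε₁ → ε₁ ≤ C.a₁ → ∀ (V U : Site d → Fin d → (Matrix n n ℂ)ˣ), V ∈ sfClass d L N ε₁ 0 →
      IsMinimiser d (sfClass d L N (C.B₃ * ε₁)) L N (k + 1) V U →
        ∀ x : Site d, Regularity (torusVP d L N G (k + 1)) C.B₃ C.B₄ ε₁ U (x, L ^ (k + 1) - 1 + L ^ (k + 1) + 2))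
    (hE : ∀ (k : ℕ) (ε₁ : ℝ), 0 < ε₁ → ε₁ ≤ C.a₁ → ∀ V : Site d → Fin d → (Matrix n n ℂ)ˣ, V ∈ sfClass d L N ε₁ 0 →
      ∃ U : Site d → Fin d → (Matrix n n ℂ)ˣ, IsMinimiser d (sfClass d L N (C.B₃ * ε₁)) L N (k + 1) V U)
    {ε ρ : ℝ} (hρ : 0 < ρ) (hρε : ρ ≤ ε) (hεa : ε ≤ C.B₃ * C.a₁) (hρ28 : ρ ≤ 1 / 28)
    {D : Set (Site d → Fin d → (Matrix n n ℂ)ˣ)} (hD : D ⊆ sfClass d L N (ρ / C.B₃) 0)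
    (hcap : ∀ V ∈ D, ∀ (k : ℕ) (U : Site d → Fin d → (Matrix n n ℂ)ˣ), IsMinimiser d (sfClass d L N ε) L N (k + 1) V U → U ∈ sfClass d L N ρ (k + 1)) :
    ∃ sel : ℕ → (Site d → Fin d → (Matrix n n ℂ)ˣ) → (Site d → Fin d → (Matrix n n ℂ)ˣ),
      ∀ V ∈ D, ∀ k : ℕ, IsMinimiser d (sfClass d L N ε) L N (k + 1) V (sel k V) ∧ RegularSup d L N ρ (16937 * ρ) (k + 1) (sel k V) := by
  classical
  have hε : 0 < ε := lt_of_lt_of_le hρ hρε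
  have hρa : ρ ≤ C.B₃ * C.a₁ := hρε.trans hεa
  have hDε : D ⊆ sfClass d L N (ε / C.B₃) 0 :=
    fun V hV => sfClass_mono (div_le_div_of_nonneg_right hρε C.B₃_pos.le) (hD hV)
  have hex : ∀ (k : ℕ) (V : Site d → Fin d → (Matrix n n ℂ)ˣ), ∃ U : Site d → Fin d → (Matrix n n ℂ)ˣ,
      V ∈ D → IsMinimiser d (sfClass d L N ε) L N (k + 1) V U := by
    intro k V
    by_cases hV : V ∈ D
    · obtain ⟨U, hU⟩ := exists_isMinimiser_succ_of_exists8Min C hE hε hεa (hDε hV) k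
      exact ⟨U, fun _ => hU⟩
    · exact ⟨V, fun h => absurd h hV⟩
  choose sel hsel using hex
  have hleaf := leafH3sup_interior_of_reg910Slot_of_capture hL hGm hG C hR hρ hρε hρa hρ28 hD hcap
  exact ⟨sel, fun V hV k => ⟨hsel k V hV, hleaf V hV k _ (hsel k V hV)⟩⟩

/-- **★ NODE N19's TWO `sel` ROWS AT EVERY RUN FROM (T8), THE SLOT KEY, CAPTURE AND THE LEVEL-0 LEAF** (file 7's `exists_sel_of_thm1At_torusVP_of_capture` re-keyed): with
letters `b ≥ ρ`, `c' ≥ 16937ρ` and a datum radius `ε₁ ≤ min(ε, 1∕4, b, c'∕4)` with `D ⊆ sfClass ε₁ 0`, ONE selection with `IsMinimiser … k V (sel k V)` and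
`RegularSup … b c' k (sel k V)` for EVERY run `k` (run `0`: the datum; runs `k+1`: the previous theorem). [cite: Balaban1985Variational, Thm 1 (8)–(10) p.279] -/
theorem exists_sel_of_reg910Slot_of_capture [Nonempty n] {L N : ℕ} (hL : 1 ≤ L)
    {G : (Site d → Fin d → (Matrix n n ℂ)ˣ) → Site d → ℕ → ℝ → ℝ → ℝ → Prop} (hGm : RadiiMono d G)
    (hG : ∀ (U : Site d → Fin d → (Matrix n n ℂ)ˣ) (x : Site d) (K : ℕ) (α₀ α₁ α₂ : ℝ), 2 ≤ K → G U x K α₀ α₁ α₂ →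
      ∃ (u : Site d → (Matrix n n ℂ)ˣ) (a : Site d → Fin d → Matrix n n ℂ),
        (∀ z, u z ∈ unitaryUnits (Matrix n n ℂ)) ∧
        (∀ (y : Site d) (τ : Fin d), l1 (y - x) ≤ 2 → ((gaugeAct u U y τ : (Matrix n n ℂ)ˣ) : Matrix n n ℂ) = exp (a y τ)) ∧
        (∀ (y : Site d) (τ : Fin d), l1 (y - x) ≤ 2 → ‖a y τ‖ ≤ α₀) ∧
        (∀ (y : Site d) (τ i : Fin d), l1 (y - x) ≤ 1 → ‖fd i (fun z => a z τ) y‖ ≤ α₁) ∧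
        (∀ (τ i l : Fin d), ‖fd i (fd l (fun z => a z τ)) x‖ ≤ α₂))
    (C : B11Thm1.Consts)
    (hR : ∀ (k : ℕ) (ε₁ : ℝ), 0 < ε₁ → ε₁ ≤ C.a₁ → ∀ (V U : Site d → Fin d → (Matrix n n ℂ)ˣ), V ∈ sfClass d L N ε₁ 0 →
      IsMinimiser d (sfClass d L N (C.B₃ * ε₁)) L N (k + 1) V U →
        ∀ x : Site d, Regularity (torusVP d L N G (k + 1)) C.B₃ C.B₄ ε₁ U (x, L ^ (k + 1) - 1 + L ^ (k + 1) + 2))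
    (hE : ∀ (k : ℕ) (ε₁ : ℝ), 0 < ε₁ → ε₁ ≤ C.a₁ → ∀ V : Site d → Fin d → (Matrix n n ℂ)ˣ, V ∈ sfClass d L N ε₁ 0 →
      ∃ U : Site d → Fin d → (Matrix n n ℂ)ˣ, IsMinimiser d (sfClass d L N (C.B₃ * ε₁)) L N (k + 1) V U)
    {ε ρ b c' ε₁ : ℝ} (hρ : 0 < ρ) (hρε : ρ ≤ ε) (hεa : ε ≤ C.B₃ * C.a₁) (hρ28 : ρ ≤ 1 / 28) (hρb : ρ ≤ b) (hρc : 16937 * ρ ≤ c')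
    (hε₁ε : ε₁ ≤ ε) (hε₁ : ε₁ ≤ 1 / 4) (hε₁b : ε₁ ≤ b) (hε₁c : 4 * ε₁ ≤ c')
    {D : Set (Site d → Fin d → (Matrix n n ℂ)ˣ)} (hD : D ⊆ sfClass d L N (ρ / C.B₃) 0) (hD₁ : D ⊆ sfClass d L N ε₁ 0)
    (hcap : ∀ V ∈ D, ∀ (k : ℕ) (U : Site d → Fin d → (Matrix n n ℂ)ˣ), IsMinimiser d (sfClass d L N ε) L N (k + 1) V U → U ∈ sfClass d L N ρ (k + 1)) :
    ∃ sel : ℕ → (Site d → Fin d → (Matrix n n ℂ)ˣ) → (Site d → Fin d → (Matrix n n ℂ)ˣ),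
      (∀ V ∈ D, ∀ k : ℕ, IsMinimiser d (sfClass d L N ε) L N k V (sel k V)) ∧
      (∀ V ∈ D, ∀ k : ℕ, RegularSup d L N b c' k (sel k V)) := by
  obtain ⟨sel, hsel⟩ := exists_sel_succ_of_reg910Slot_of_capture hL hGm hG C hR hE hρ hρε hεa hρ28 hD hcap
  refine ⟨fun k V => match k with | 0 => V | k + 1 => sel k V, fun V hV k => ?_, fun V hV k => ?_⟩
  · cases k with
    | zero => exact isMinimiser_zero (sfClass_mono hε₁ε (hD₁ hV))
    | succ k => exact (hsel V hV k).1
  · cases k with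
    | zero => exact regularSup_zero_of_sfClass_le hε₁ hε₁b hε₁c (hD₁ hV)
    | succ k => exact ((hsel V hV k).2).mono hρb hρc


end

end Summit.QuantumFields.YangMills.BalabanUVNodes.N16H7LooseOfReg910Slot
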